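import Summits.QuantumFields.BalabanUV.T4Continuum.Support.NE7ApeCurvedRepSameTopCriticalFourTerm
import Summits.QuantumFields.BalabanUV.T4Continuum.Support.NE7PointedRepModGauge
import Summits.QuantumFields.BalabanUV.T4Continuum.Support.NE7PointedRepLinearisation
import HarnessLib

/-!
# NE7ApeCurvedRepPointedGaugeFourTerm — O2 RE-THREAD, FILE 5 (the one that needed design): road (B)'s pointed-gauge (APE) `NE7ApeCurvedRepPointedGaugeH` RE-CUT on F156.  HERE
# the END's KNOWN gauge part enters: the representative is `Z′ = Z − gaugeDir_W σ̃ + N_corr` (`‖N_corr‖ ≤ 4(t+δ)(α+δ)`), so the four-term root is fed `σ := σ̃` (`Ξ := t`) —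
# `curl_W(gaugeDir_W σ̃)` is then priced by `K_Ξ`, NOT through a divergence (memo O2: pricing `σ̃` through `‖D^*·‖` costs `θ_u`, not closing) — and the divergence datum of
# `(Z′ − A_N) + gaugeDir_W σ̃ = N_corr + Z − A_N` is DISCHARGED as `d_C + b_Z + d_N` from three DISPLAYED pieces: the pointing correction's divergence letter `hDivCorr` (`d_C`;
# memo O2: face-supported, to be priced with the surface gain), E′'s divergence of `Z` (`b_Z = b₀ + 3c_RE b₀` downstream), the normal lift's (`d_N`, new clause of `hNlift`)
# (file 87 of the curved (APE), F157)

Cell `pub-balaban`, rung (B)+1 sub-cell t4, lineage `b2b-balaban-t4-ne7-p1` (CRUX PROVER NE7 #1 = OWNER of row NE7), generation 82; memo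
`t4/b2b-balaban-t4-ne7-p1-g82/LOCALISATION-ROAD.md` §2 (O2, pricing detail).  Twin of `NE7ApeCurvedRepPointedGaugeH` (gen 80; F108's road) over F156
`NE7ApeCurvedRepSameTopCriticalFourTerm`; the pointed gauge, `Z′`, its structure and top EXACTLY as there (F105∕F106∕`NE7GradientCurrency`).
WHY.  See the title; this is the file where the four-term letter's two new currencies meet the END's objects.  The successor: `…RoadB` (E′ supplies `u, Z` with `b_Z := b₀ + 3c_RE b₀`,
F109 supplies `σ̃` with `t = 2θ_u`), `…RoadBLifted` (F111 supplies `A_N`: add skewness + a divergence bound), then the priced∕sharp∕gradient∕class files with `+ K_D(d_C + b_Z + d_N) + K_Ξ t`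
carried next to `K_X(α₀ + a_N)`; `hDivCorr` stays a displayed letter until the desk prices the pointing correction's divergence (bulk∕face).
WHAT ([folklore]; 0 def, 0 sorry).  **`smallField_of_tanCritical_pointedGauge_fourTerm`**.
HONEST FRAMING (page 1): composition + `exp`∕`log` kinematics over DISPLAYED letters (four-term letter, (L1)′ with divergence clause, α₁, `hDivCorr`); nothing of Bałaban's asserted;
(APE) on curved data NOT proved; NOT ONE-STEP, NOT NE7; spine 0∕9; finite T⁴ rung (B)+1 — NOT infinite volume, NOT mass gap, NOT `BetaPertH`, NOT Clay.  Continuum YM on T⁴ ⇐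
BetaPertH ∧ nine spine estimates (0/9 proved); BetaPertH ⇐ (D1) ∧ (D4) ∧ CAP+tail; G-an2-4 gates asym, D1 and NE2/3/4.
-/

set_option autoImplicit false

open scoped BigOperators Matrix Matrix.Norms.L2Operator
open NormedSpace Finset

namespace Summit.QuantumFields.BalabanUV.T4Continuum.NE7ApeCurvedRepPointedGaugeFourTerm

open Literature.MathematicalPhysics.QuantumFieldTheory.Balaban1983to89
open B7Prop1Explicit B7Prop2Explicit MatrixLog UnitaryModel
open T4AveragingDeficitWall (Ad IsUnitaryCfg IsSkewDir SmallField vary curlAt dirL1)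
open T4AveragingDeficitWallBoundary (IsPeriodicCfg periodBox)
open AveragingDeficitPeriodicCounting (IsPeriodicDir)
open AveragingDeficitTwoLevelPrep (twoLevelSmall)
open AveragingDeficitMultiLevelPrep (cavgIter LevelSmall)
open AveragingDeficitTransport (norm_Ad_of_unitary Ad_mem_skewAdjoint)
open MinimalActionLevels (perWin)
open BlockAverageVaryHolo (nbRad)
open BlockAveragePushDirGauge (gaugeDir)
open NE3HessForm (hess dAction)
open NE3TangentCovariantTower (dirIter)
open NE3EnergyShapes (IsUnitarySite IsPeriodicSite)
open NE3QbarIterCovLiftPrep (cruxC)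
open NE3RightInverseSolveLetters (thetaLoc)
open NE3HatInvCurlLetters (curl1C)
open NE3.CurvedLandauNewtonStep (isSkewDir_mlog_rel isPeriodicDir_mlog_rel isUnitaryCfg_gaugeAct_W)
open NE3ResidualSliceRep (isPeriodicCfg_gaugeAct)
open NE7ExpLogSecondOrder (real_exp_sub_one_le_two_mul)
open NE7GradientCurrency (norm_mul_sub_one_le_of_le norm_exp_sub_one_le)
open NE7ApeCurvedRepSameTopCriticalFourTerm (smallField_of_tanCritical_repSameTop_critBackground_fourTerm)
open NE7PointedRepModGauge (cavgIter_pointed_eq)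
open NE7PointedRepLinearisation (relLink_pointed_eq norm_mlog_relLink_pointed_sub_le)

open NE3CovariantWeitzenbock (covDiv)

noncomputable section

variable {d : ℕ} {n : Type*} [Fintype n] [DecidableEq n]

/-- **(APE) WITH A DATUM AT A TANGENT-CRITICAL BACKGROUND, ROAD (B), FOUR-TERM SLICE-SOLVER LETTER** — `NE7ApeCurvedRepPointedGaugeH.smallField_of_tanCritical_pointedGauge` with
`(S, hG)` ↦ the four-term letter `h4`, `hNlift`'s membership clause ↦ `IsSkewDir A_N ∧ ‖covDiv W A_N‖ ≤ d_N`, PLUS the divergence data: `‖covDiv W Z‖ ≤ b_Z` of the displayed `Z` and the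
letter `hDivCorr` (divergence of the pointing correction `Z′ − (Z − gaugeDir_W σ̃)` on the same-top structured fields, `≤ d_C`); the root's gauge parameter is THE KNOWN `σ := σ̃`
(`Ξ := t`) and its divergence datum is DISCHARGED as `d_C + b_Z + d_N`; conclusion = the original radius `+ K_D·(d_C + b_Z + d_N) + K_Ξ·t`. [folklore] -/
theorem smallField_of_tanCritical_pointedGauge_fourTerm [Nonempty n] (hd : 2 ≤ d) {L N : ℕ} [NeZero N] (hL : 2 ≤ L) (j : ℕ)
    -- the background
    {W : Site d → Fin d → (Matrix n n ℂ)ˣ} {x : ℝ} (hWu : IsUnitaryCfg W) (hWP : IsPeriodicCfg W ((N * L ^ (j + 1) : ℕ) : ℤ))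
    (hx : 0 ≤ x) (hs : LevelSmall d L j x) (hWx : SmallField W x)
    -- the sup radius of the representative and the regime at `x′ = x + 4(e^{α₀} − 1)`
    {α₀ : ℝ} (hα0 : 0 ≤ α₀) (hs' : LevelSmall d L j (x + 4 * (Real.exp α₀ - 1)))
    (hθ : cruxC d L * (((L : ℝ) ^ (j + 1)) ^ 2 * (x + 4 * (Real.exp α₀ - 1))) < 1)
    (hθl : thetaLoc d L * (((L : ℝ) ^ (j + 1)) ^ 2 * (x + 4 * (Real.exp α₀ - 1))) < 1)
    (hε : ((L : ℝ) ^ (j + 1)) ^ 2 * (x + 4 * (Real.exp α₀ - 1)) ≤ 1)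
    -- the field: of the class, tangent-critical, over `W`'s datum
    {U : Site d → Fin d → (Matrix n n ℂ)ˣ} (hUu : IsUnitaryCfg U) (hUP : IsPeriodicCfg U ((N * L ^ (j + 1) : ℕ) : ℤ))
    {xU : ℝ} (hxU : 0 ≤ xU) (hsU : LevelSmall d L j xU) (hUxU : SmallField U xU)
    (hcritU : ∀ Y : Site d → Fin d → Matrix n n ℂ, IsSkewDir Y → IsPeriodicDir Y ((N * L ^ (j + 1) : ℕ) : ℤ) →
      dirIter L (j + 1) U Y = 0 → dAction U Y (perWin d (N * L ^ (j + 1))) = 0)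
    (hTopUW : cavgIter L (j + 1) U = cavgIter L (j + 1) W)
    -- the DISPLAYED representative `U^u = W e^{Z}` (E′) and the DISPLAYED extension `e^{σ̃}` of the corner values of `u`
    {u : Site d → (Matrix n n ℂ)ˣ} (huU : IsUnitarySite u) (huP : IsPeriodicSite u ((N * L ^ (j + 1) : ℕ) : ℤ))
    {Z : Site d → Fin d → Matrix n n ℂ} (hrep : gaugeAct u U = vary W Z 1) {α : ℝ} (hZα : ∀ y μ, ‖Z y μ‖ ≤ α) (hα40 : α ≤ 1 / 40)
    {σ : Site d → Matrix n n ℂ} (hσs : ∀ y, σ y ∈ skewAdjoint (Matrix n n ℂ)) (hσP : ∀ (y : Site d) (i : Fin d), σ (y + ((N * L ^ (j + 1) : ℕ) : ℤ) • e i) = σ y)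
    (hext : ∀ w : Site d, expUnit (σ ((((L ^ (j + 1) : ℕ) : ℤ)) • w)) = u ((((L ^ (j + 1) : ℕ) : ℤ)) • w))
    {t δ : ℝ} (hσt : ∀ y, ‖σ y‖ ≤ t) (hσδ : ∀ (y : Site d) (κ : Fin d), ‖gaugeDir W σ y κ‖ ≤ δ) (ht40 : t ≤ 1 / 40) (hδ40 : δ ≤ 1 / 40)
    (hα₀ : α + δ + 4 * (t + δ) * (α + δ) ≤ α₀)
    -- the remaining analytic letters at `W`: (L1)′ and α₁ for the SAME-TOP structured fields of radius `α₀`, (L2), (L3) discharged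
    {cN aN dN dC bZ KG KX KD KΞ ν : ℝ} (hν : 0 ≤ ν)
    -- the divergence data (memo O2): E′'s divergence of the displayed `Z`, the pointing correction's divergence letter, the normal lift's divergence (in `hNlift`)
    (hZdiv : ∀ y : Site d, ‖covDiv W Z y‖ ≤ bZ)
    (hDivCorr : ∀ Z' : Site d → Fin d → Matrix n n ℂ, IsSkewDir Z' → IsPeriodicDir Z' ((N * L ^ (j + 1) : ℕ) : ℤ) →
      (∀ y μ, ‖Z' y μ‖ ≤ α₀) → cavgIter L (j + 1) (vary W Z' 1) = cavgIter L (j + 1) W →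
      (∀ (y : Site d) (μ : Fin d), ‖Z' y μ - (Z y μ - gaugeDir W σ y μ)‖ ≤ 4 * (t + δ) * (α + δ)) →
      ∀ y : Site d, ‖covDiv W (fun z κ => Z' z κ - (Z z κ - gaugeDir W σ z κ)) y‖ ≤ dC)
    (hNlift : ∀ Z' : Site d → Fin d → Matrix n n ℂ, IsSkewDir Z' → IsPeriodicDir Z' ((N * L ^ (j + 1) : ℕ) : ℤ) →
      (∀ y μ, ‖Z' y μ‖ ≤ α₀) → cavgIter L (j + 1) (vary W Z' 1) = cavgIter L (j + 1) W →
      (∀ (y : Site d) (μ : Fin d), ‖Z' y μ - (Z y μ - gaugeDir W σ y μ)‖ ≤ 4 * (t + δ) * (α + δ)) →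
      ∃ AN : Site d → Fin d → Matrix n n ℂ, IsPeriodicDir AN ((N * L ^ (j + 1) : ℕ) : ℤ) ∧ (∀ y μ, ‖AN y μ‖ ≤ aN) ∧
        dirIter L (j + 1) W AN = dirIter L (j + 1) W Z' ∧
        (∀ z μ' ν', μ' ≠ ν' → ‖curlAt W AN z μ' ν'‖ ≤ cN) ∧
        (∀ Y : Site d → Fin d → Matrix n n ℂ, IsSkewDir Y → IsPeriodicDir Y ((N * L ^ (j + 1) : ℕ) : ℤ) → dirIter L (j + 1) W Y = 0 →
          |hess W AN Y (perWin d (N * L ^ (j + 1)))| ≤ ν * dirL1 Y (periodBox (d := d) (N * L ^ (j + 1)))) ∧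
        IsSkewDir AN ∧ (∀ y : Site d, ‖covDiv W AN y‖ ≤ dN))
    {α₁ : ℝ} (hα1 : 0 ≤ α₁)
    (hGrad : ∀ Z' : Site d → Fin d → Matrix n n ℂ, IsSkewDir Z' → IsPeriodicDir Z' ((N * L ^ (j + 1) : ℕ) : ℤ) →
      (∀ y μ, ‖Z' y μ‖ ≤ α₀) → cavgIter L (j + 1) (vary W Z' 1) = cavgIter L (j + 1) W →
      (∀ (y : Site d) (μ : Fin d), ‖Z' y μ - (Z y μ - gaugeDir W σ y μ)‖ ≤ 4 * (t + δ) * (α + δ)) →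
      ∀ (y : Site d) (κ τ : Fin d), ‖Ad (W (y + e κ) τ) (Z' (y + e τ) κ) - Z' y κ‖ ≤ α₁)
    -- THE FOUR-TERM SLICE-SOLVER LETTER (F152's shape) on all skew periodic `W`-tangent fields
    (h4 : ∀ X : Site d → Fin d → Matrix n n ℂ, IsSkewDir X →
      IsPeriodicDir X ((N * L ^ (j + 1) : ℕ) : ℤ) → dirIter L (j + 1) W X = 0 → ∀ R : ℝ, (∀ y κ', ‖X y κ'‖ ≤ R) → ∀ g : ℝ, 0 ≤ g →
      (∀ Y : Site d → Fin d → Matrix n n ℂ, IsSkewDir Y → IsPeriodicDir Y ((N * L ^ (j + 1) : ℕ) : ℤ) → dirIter L (j + 1) W Y = 0 →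
        |hess W X Y (perWin d (N * L ^ (j + 1)))| ≤ g * dirL1 Y (periodBox (d := d) (N * L ^ (j + 1)))) →
      ∀ σ' : Site d → Matrix n n ℂ, (∀ y, σ' y ∈ skewAdjoint (Matrix n n ℂ)) →
      (∀ (y : Site d) (i : Fin d), σ' (y + ((N * L ^ (j + 1) : ℕ) : ℤ) • e i) = σ' y) → ∀ Ξ' : ℝ, (∀ y, ‖σ' y‖ ≤ Ξ') →
      ∀ D : ℝ, (∀ y, ‖covDiv W (fun z κ => X z κ + gaugeDir W σ' z κ) y‖ ≤ D) →
      ∀ z μ' ν', μ' ≠ ν' → ‖curlAt W X z μ' ν'‖ ≤ KG * g + KX * R + KD * D + KΞ * Ξ')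
    (hcritW : ∀ Y : Site d → Fin d → Matrix n n ℂ, IsSkewDir Y → IsPeriodicDir Y ((N * L ^ (j + 1) : ℕ) : ℤ) → dirIter L (j + 1) W Y = 0 →
      dAction W Y (perWin d (N * L ^ (j + 1))) = 0) :
    SmallField U (x + (KG * (
        ((x + 4 * (Real.exp α₀ - 1))
            * ((curl1C d L / (1 - thetaLoc d L * (((L : ℝ) ^ (j + 1)) ^ 2 * (x + 4 * (Real.exp α₀ - 1)))))
                * (((L : ℝ) ^ (j + 1)) ^ d / ((L : ℝ) ^ (j + 1)) ^ 2))
            * (Real.exp (((L : ℝ) ^ d / L) * ((d : ℝ) * (16 * ((d : ℝ) + 1) * ((d : ℝ) + 4) * (L : ℝ) ^ 2)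
                  * (1250 * ((nbRad d L : ℝ) + L) + 8 * ((d : ℝ) * L) + 2 * L)) * (2 / twoLevelSmall d L))
                * ((L : ℝ) / (L : ℝ) ^ d) ^ j
                * (((d : ℝ) * (2 * nbRad d L + 1) ^ d) * ((2 * (d : ℝ) + 4) * (L : ℝ) ^ 2) * (2 * (L : ℝ) ^ j) * (Real.exp α₀ - 1)
                  + (17 / 8 * ((L : ℝ) ^ 2) ^ j * (x + 4 * (Real.exp α₀ - 1)))
                    * (((d : ℝ) * (2 * nbRad d L + 1) ^ d) * ((2 * (d : ℝ) + 4)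
                          * (2 * (2 * L * (nbRad d L : ℝ) + 128 * ((d : ℝ) + 1) * ((d : ℝ) + 4) * (L : ℝ) ^ 2)))
                      + ((d : ℝ) * (2 * nbRad d L + 1) ^ d) * ((2 * (d : ℝ) + 4) * (L : ℝ) ^ 2 * (2 * (nbRad d L : ℝ))
                          + 2 * (8 * (L : ℝ) + (1250 * ((nbRad d L : ℝ) + L) + 8 * (d * L) + 2 * L))
                              * (16 * ((d : ℝ) + 1) * ((d : ℝ) + 4) * (L : ℝ) ^ 2))))))
        + (Fintype.card (T4AveragingDeficitWall.Plane d) : ℝ)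
          * (2 * (240 * (Real.exp α₀ - 1) * α₀ * (2 * α₁ + 24 * α₀ * (Real.exp α₀ - 1) + x) + 8 * α₀ * (2 * α₁ + 24 * α₀ * (Real.exp α₀ - 1))
              + 6 * (Real.exp α₀ - 1) * (2 * α₁ + 24 * (Real.exp α₀ - 1) * α₀)
              + (2 * α₁ + 24 * (Real.exp α₀ - 1) * α₀) * (2 * α₁ + 24 * α₀ * (Real.exp α₀ - 1))
              + 960 * (Real.exp α₀ - 1) * α₀ ^ 2 + 32 * x * α₀ ^ 2)
            + (64 * α₀ * α₁ + 1024 * x * α₀ ^ 2))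
        + ν) + KX * (α₀ + aN) + KD * (dC + bZ + dN) + KΞ * t + cN + 28 * α₀ ^ 2)) := by
  letI : CStarAlgebra (Matrix n n ℂ) := {}
  letI : NormedAlgebra ℚ (Matrix n n ℂ) := NormedAlgebra.restrictScalars ℚ ℝ (Matrix n n ℂ)
  have hL1 : 1 ≤ L := by omega
  have ht0 : 0 ≤ t := (norm_nonneg _).trans (hσt 0)
  have hαZ0 : 0 ≤ α := (norm_nonneg _).trans (hZα 0 ⟨0, by omega⟩)
  have hδ0 : 0 ≤ δ := (norm_nonneg _).trans (hσδ 0 ⟨0, by omega⟩)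
  -- the extension `c̃ = e^{σ̃}` and the pointed gauge `u′ = c̃⁻¹ u`
  set ct : Site d → (Matrix n n ℂ)ˣ := fun y => expUnit (σ y) with hct
  have hcU : IsUnitarySite ct := fun y => mem_unitaryUnits.mpr (by rw [hct, val_expUnit]; exact exp_mem_unitary_of_mem_skewAdjoint (hσs y))
  have hcP : IsPeriodicSite ct ((N * L ^ (j + 1) : ℕ) : ℤ) := fun y i => by simp only [hct, hσP y i]
  set u' : Site d → (Matrix n n ℂ)ˣ := fun y => (ct y)⁻¹ * u y with hu'
  have hu'U : IsUnitarySite u' := fun y => (unitaryUnits _).mul_mem ((unitaryUnits _).inv_mem (hcU y)) (huU y)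
  have hu'P : IsPeriodicSite u' ((N * L ^ (j + 1) : ℕ) : ℤ) := fun y i => by simp only [hu', hcP y i, huP y i]
  have hVu : IsUnitaryCfg (gaugeAct u' U) := isUnitaryCfg_gaugeAct_W hu'U hUu
  have hVP : IsPeriodicCfg (gaugeAct u' U) ((N * L ^ (j + 1) : ℕ) : ℤ) := isPeriodicCfg_gaugeAct hu'P hUP
  -- closeness of the relative link `W⁻¹U^{u′} = e^{T̂}e^{Z}e^{σ̃'}` to `1`: `≤ e^{2t+α} − 1 ≤ 2(2t + α) ≤ 1∕4`
  have hclose : ∀ (y : Site d) (μ : Fin d), ‖(((W y μ)⁻¹ * gaugeAct u' U y μ : (Matrix n n ℂ)ˣ) : Matrix n n ℂ) - 1‖ ≤ 2 * (2 * t + α) := by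
    intro y μ
    rw [hu', relLink_pointed_eq hrep σ y μ]
    have hWi : (W y μ)⁻¹ ∈ unitaryUnits (Matrix n n ℂ) := (unitaryUnits _).inv_mem (hWu y μ)
    have h1 : ‖exp (Ad (W y μ)⁻¹ (-σ y)) - 1‖ ≤ Real.exp t - 1 :=
      norm_exp_sub_one_le (by rw [norm_Ad_of_unitary hWi, norm_neg]; exact hσt y)
    have h2 : ‖exp (Z y μ) - 1‖ ≤ Real.exp α - 1 := norm_exp_sub_one_le (hZα y μ)
    have h3 : ‖exp (-(-σ (y + e μ))) - 1‖ ≤ Real.exp t - 1 := norm_exp_sub_one_le (by rw [neg_neg]; exact hσt _)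
    have h12 := norm_mul_sub_one_le_of_le h1 h2
    have h123 := norm_mul_sub_one_le_of_le h12 h3
    have hexp : Real.exp t * Real.exp α * Real.exp t = Real.exp (2 * t + α) := by
      rw [← Real.exp_add, ← Real.exp_add]; ring_nf
    have hsmall : Real.exp (2 * t + α) - 1 ≤ 2 * (2 * t + α) := real_exp_sub_one_le_two_mul (by positivity) (by linarith)
    linarith [h123]
  have hquarter : 2 * (2 * t + α) ≤ 1 / 4 := by linarith
  -- the same-top representative `Z′ := log(W⁻¹U^{u′})`
  set Z' : Site d → Fin d → Matrix n n ℂ := fun y μ => mlog (((W y μ)⁻¹ * gaugeAct u' U y μ : (Matrix n n ℂ)ˣ) : Matrix n n ℂ) with hZ'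
  have hZ's : IsSkewDir Z' := isSkewDir_mlog_rel hWu hVu fun y μ => (hclose y μ).trans hquarter
  have hZ'P : IsPeriodicDir Z' ((N * L ^ (j + 1) : ℕ) : ℤ) := isPeriodicDir_mlog_rel hWP hVP
  have hrep' : gaugeAct u' U = vary W Z' 1 := by
    funext y μ
    refine Units.ext ?_
    have h1 : ‖(((W y μ)⁻¹ * gaugeAct u' U y μ : (Matrix n n ℂ)ˣ) : Matrix n n ℂ) - 1‖ < 1 := (hclose y μ).trans_lt (by linarith)
    have h2 : exp (Z' y μ) = (((W y μ)⁻¹ * gaugeAct u' U y μ : (Matrix n n ℂ)ˣ) : Matrix n n ℂ) := exp_mlog h1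
    rw [show (vary W Z' 1 y μ : (Matrix n n ℂ)ˣ) = W y μ * expUnit (((1 : ℝ) : ℂ) • Z' y μ) from rfl, Units.val_mul, val_expUnit,
      Complex.ofReal_one, one_smul, h2, Units.val_mul, ← mul_assoc, Units.mul_inv, one_mul]
  -- the structure and the radius of `Z′`
  have hstruct : ∀ (y : Site d) (μ : Fin d), ‖Z' y μ - (Z y μ - gaugeDir W σ y μ)‖ ≤ 4 * (t + δ) * (α + δ) := fun y μ => by
    rw [hZ', hu']; exact norm_mlog_relLink_pointed_sub_le hWu hrep hσs hσt hZα hσδ ht40 hα40 hδ40 y μ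
  have hZ'α : ∀ y μ, ‖Z' y μ‖ ≤ α₀ := by
    intro y μ
    have e1 : Z' y μ = (Z' y μ - (Z y μ - gaugeDir W σ y μ)) + (Z y μ - gaugeDir W σ y μ) := by abel
    rw [e1]
    calc ‖(Z' y μ - (Z y μ - gaugeDir W σ y μ)) + (Z y μ - gaugeDir W σ y μ)‖
        ≤ ‖Z' y μ - (Z y μ - gaugeDir W σ y μ)‖ + ‖Z y μ - gaugeDir W σ y μ‖ := norm_add_le _ _
      _ ≤ 4 * (t + δ) * (α + δ) + (α + δ) := add_le_add (hstruct y μ) ((norm_sub_le _ _).trans (add_le_add (hZα y μ) (hσδ y μ)))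
      _ ≤ α₀ := by linarith
  -- the top is kept: `cavgIter (We^{Z′}) = cavgIter (U^{u′}) = cavgIter U = cavgIter W`
  have hext' : ∀ w : Site d, ct (((L : ℤ) ^ (j + 1)) • w) = u (((L : ℤ) ^ (j + 1)) • w) := fun w => by
    have h := hext w
    push_cast at h
    simpa only [hct] using h
  have hTopZ' : cavgIter L (j + 1) (vary W Z' 1) = cavgIter L (j + 1) W := by
    rw [← hrep', ← hTopUW]
    exact cavgIter_pointed_eq hL1 j hUu hxU hsU hUxU huU hcU hext'
  -- the letters at `Z′`, and F78
  obtain ⟨AN, hNP, hNsup, hNexact, hN7, hNorth, hNs, hNdiv⟩ := hNlift Z' hZ's hZ'P hZ'α hTopZ' hstruct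
  have hZ1 := hGrad Z' hZ's hZ'P hZ'α hTopZ' hstruct
  have hC := hDivCorr Z' hZ's hZ'P hZ'α hTopZ' hstruct
  -- the divergence datum of the re-gauged difference field with the KNOWN gauge parameter `σ` (memo O2): `(Z′ − A_N) + gaugeDir σ = (Z′ − (Z − gaugeDir σ)) + Z − A_N`
  have hDv : ∀ y : Site d, ‖covDiv W (fun z κ => (Z' z κ - AN z κ) + gaugeDir W σ z κ) y‖ ≤ dC + bZ + dN := by
    intro y
    have hsplit : covDiv W (fun z κ => (Z' z κ - AN z κ) + gaugeDir W σ z κ) y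
        = covDiv W (fun z κ => Z' z κ - (Z z κ - gaugeDir W σ z κ)) y + covDiv W Z y - covDiv W AN y := by
      simp only [covDiv, Ad, Matrix.mul_sub, Matrix.sub_mul, Matrix.mul_add, Matrix.add_mul, Finset.sum_sub_distrib, Finset.sum_add_distrib]
      abel
    rw [hsplit]
    calc ‖covDiv W (fun z κ => Z' z κ - (Z z κ - gaugeDir W σ z κ)) y + covDiv W Z y - covDiv W AN y‖
        ≤ ‖covDiv W (fun z κ => Z' z κ - (Z z κ - gaugeDir W σ z κ)) y + covDiv W Z y‖ + ‖covDiv W AN y‖ := norm_sub_le _ _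
      _ ≤ (‖covDiv W (fun z κ => Z' z κ - (Z z κ - gaugeDir W σ z κ)) y‖ + ‖covDiv W Z y‖) + ‖covDiv W AN y‖ := by
          gcongr; exact norm_add_le _ _
      _ ≤ (dC + bZ) + dN := add_le_add (add_le_add (hC y) (hZdiv y)) (hNdiv y)
  exact smallField_of_tanCritical_repSameTop_critBackground_fourTerm hd hL j hWu hWP hx hs hWx hα0 hs' hθ hθl hε hUu hxU hsU hUxU hcritU hu'U hu'P hZ's hZ'P hrep' hZ'α
    hTopZ' hν hNP hNsup hNexact hN7 hNorth hNs hσs hσP hσt hDv hα1 hZ1 h4 hcritW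

end

end Summit.QuantumFields.BalabanUV.T4Continuum.NE7ApeCurvedRepPointedGaugeFourTerm
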